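import Summits.AtomisticToContinuum.BoseEinsteinCondensation.Theses.BECStronglyRayleigh
import Literature.MathematicalPhysics.QuantumLattice.LiebMattisLadder
import HarnessLib

/-!
# The one-site field factor preserves stability: stub `stub_siteFactor` of line
# `stable-cone-variational-selection` for crux `GroundStateStability` (stmt-AtomisticToContinuum-9672)

Stub B2 of the skeleton `Cruxes/GroundStateStability/Lines/stable-cone-variational-selection.lean`.
Conventions (as in the crux): occupied = spin up = `Fin`-index `0`; the occupation polynomial of
`φ : TensorIndex Λ 2 → ℂ` is `P_φ(z) = Σ_S φ(1_S) ∏_{i∈S} z_i`, `1_S = fun i => if i ∈ S then 0 else 1`;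
"stable" = no zero with all `Im z_i > 0`, written inline.

Claim: for real `c, t` and a site `x`, the one-site factor `exp(t·c·S³_x)` maps coefficient vectors
with stable occupation polynomial to such vectors.

Proof. `S³_x` is diagonal in the occupation basis (`LiebMattis.onSite_diagonal`), so
`exp(t c S³_x) = diag(σ ↦ e^{t c (1/2 - σ_x)})` (`Matrix.exp_diagonal`): it multiplies `φ(1_S)` by
`e^{tc/2}` if `x ∈ S` and by `e^{-tc/2}` otherwise. Hence
`P_{exp(t c S³_x) φ}(z) = e^{-tc/2} · P_φ(z')` with `z' = z` except `z'_x = e^{tc} z_x`, and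
`Im z'_x = e^{tc} Im z_x > 0`, so the hypothesis at `z'` and `e^{-tc/2} ≠ 0` conclude.
-/

noncomputable section

namespace Summit.AtomisticToContinuum.BoseEinsteinCondensation.Cruxes.GroundStateStability.StableConeVariationalSelection

open scoped BigOperators Matrix ComplexOrder
open Literature.MathematicalPhysics.QuantumLattice
open Matrix Finset

/-! ### The one-site factor is diagonal -/

/-- The scaled field generator `t • (c • S³_x)` (spin `1/2`) is the diagonal matrix
`σ ↦ t (c (1/2 - σ_x))` in the occupation basis. [folklore] -/
theorem siteFac_generator_eq_diagonal {Λ : Type*} [Fintype Λ] [DecidableEq Λ] (x : Λ) (c t : ℂ) :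
    (t • (c • siteSpin 1 x 2) : Op Λ 2) =
      Matrix.diagonal fun σ : TensorIndex Λ 2 => t * (c * ((1 : ℂ) / 2 - ((σ x : ℕ) : ℂ))) := by
  rw [siteSpin, spinVec_two, SpinOperators.spinZ, LiebMattis.onSite_diagonal, ← diagonal_smul,
    ← diagonal_smul]
  congr 1
  funext σ
  simp only [Pi.smul_apply, smul_eq_mul, Nat.cast_one]

/-- **The one-site field factor is diagonal**: `exp(t c S³_x) = diag(σ ↦ e^{t c (1/2 - σ_x)})` in
the occupation basis. [folklore] -/
theorem siteFac_exp_eq_diagonal {Λ : Type*} [Fintype Λ] [DecidableEq Λ] (x : Λ) (c t : ℂ) :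
    NormedSpace.exp (t • (c • siteSpin 1 x 2) : Op Λ 2) =
      Matrix.diagonal fun σ : TensorIndex Λ 2 =>
        Complex.exp (t * (c * ((1 : ℂ) / 2 - ((σ x : ℕ) : ℂ)))) := by
  rw [siteFac_generator_eq_diagonal, Matrix.exp_diagonal]
  congr 1
  funext σ
  rw [Pi.coe_exp, Complex.exp_eq_exp_ℂ]

/-- The entry of the one-site factor at the occupation indicator `1_S`:
`e^{tc/2}` if `x ∈ S`, `e^{-tc/2}` if `x ∉ S`; equivalently
`e^{-tc/2} · (if x ∈ S then e^{tc} else 1)`. [folklore] -/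
theorem siteFac_exp_mulVec_indicator {Λ : Type*} [Fintype Λ] [DecidableEq Λ] (x : Λ) (c t : ℂ)
    (φ : TensorIndex Λ 2 → ℂ) (S : Finset Λ) :
    (NormedSpace.exp (t • (c • siteSpin 1 x 2) : Op Λ 2) *ᵥ φ) (fun i => if i ∈ S then 0 else 1) =
      Complex.exp (-(t * c / 2)) * (if x ∈ S then Complex.exp (t * c) else 1) *
        φ (fun i => if i ∈ S then 0 else 1) := by
  rw [siteFac_exp_eq_diagonal, mulVec_diagonal]
  congr 1
  by_cases hx : x ∈ S
  · simp only [hx, if_true, Fin.val_zero, Nat.cast_zero, sub_zero]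
    rw [← Complex.exp_add]
    congr 1
    ring
  · simp only [hx, if_false, Fin.val_one, Nat.cast_one]
    rw [mul_one]
    congr 1
    ring

/-! ### The occupation polynomial of the image: a rescaling of one variable -/

/-- Rescaling one variable of the monomial `∏_{i∈S} z_i`: with `z' = z` except `z'_x = a z_x`,
`∏_{i∈S} z'_i = (if x ∈ S then a else 1) · ∏_{i∈S} z_i`. [folklore] -/
theorem siteFac_prod_update {Λ : Type*} [DecidableEq Λ] (x : Λ) (a : ℂ) (z : Λ → ℂ)
    (S : Finset Λ) :
    ∏ i ∈ S, Function.update z x (a * z x) i = (if x ∈ S then a else 1) * ∏ i ∈ S, z i := by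
  by_cases hx : x ∈ S
  · rw [prod_update_of_mem hx, if_pos hx, mul_assoc,
      ← Finset.prod_eq_mul_prod_sdiff_singleton_of_mem hx]
  · rw [prod_update_of_notMem hx, if_neg hx, one_mul]

/-- **The occupation polynomial of `exp(t c S³_x) φ` is a rescaled occupation polynomial of `φ`**:
`P_{exp(t c S³_x) φ}(z) = e^{-tc/2} · P_φ(z')`, `z' = z` except `z'_x = e^{tc} z_x`. [folklore] -/
theorem siteFac_occ_exp {Λ : Type*} [Fintype Λ] [DecidableEq Λ] (x : Λ) (c t : ℂ)
    (φ : TensorIndex Λ 2 → ℂ) (z : Λ → ℂ) :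
    (∑ S : Finset Λ, (NormedSpace.exp (t • (c • siteSpin 1 x 2) : Op Λ 2) *ᵥ φ)
        (fun i => if i ∈ S then 0 else 1) * ∏ i ∈ S, z i) =
      Complex.exp (-(t * c / 2)) *
        ∑ S : Finset Λ, φ (fun i => if i ∈ S then 0 else 1) *
          ∏ i ∈ S, Function.update z x (Complex.exp (t * c) * z x) i := by
  rw [Finset.mul_sum]
  refine Finset.sum_congr rfl fun S _ => ?_
  rw [siteFac_exp_mulVec_indicator, siteFac_prod_update]
  ring

/-! ### The stub -/

/-- **Stub B2 — the one-site factor is a positive rescaling.** `exp(t·c·S³_x)` is diagonal in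
the occupation basis with entries `e^{tc/2}` (site `x` occupied, index `0`) and `e^{-tc/2}`
(`onSite_diagonal`, `exp_diagonal`), so the occupation polynomial of `exp(t c S³_x) φ` is
`e^{-tc/2} · P_φ(z)` with `z_x` replaced by `e^{tc} z_x`, which stays in `H^Λ`. [folklore] -/
theorem stub_siteFactor :
    ∀ (Λ : Type) [Fintype Λ] [DecidableEq Λ] (x : Λ) (c t : ℝ),
      ∀ φ : TensorIndex Λ 2 → ℂ,
        (∀ z : Λ → ℂ, (∀ i, 0 < (z i).im) →
          (∑ S : Finset Λ, φ (fun i => if i ∈ S then 0 else 1) * ∏ i ∈ S, z i) ≠ 0) →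
        (∀ z : Λ → ℂ, (∀ i, 0 < (z i).im) →
          (∑ S : Finset Λ, (NormedSpace.exp ((t : ℂ) • ((c : ℂ) • siteSpin 1 x 2)) *ᵥ φ) (fun i => if i ∈ S then 0 else 1) * ∏ i ∈ S, z i) ≠ 0) := by
  intro Λ _ _ x c t φ hφ z hz
  rw [siteFac_occ_exp]
  refine mul_ne_zero (Complex.exp_ne_zero _) (hφ _ fun i => ?_)
  by_cases hi : i = x
  · subst hi
    rw [Function.update_self, ← Complex.ofReal_mul, ← Complex.ofReal_exp, Complex.im_ofReal_mul]
    exact mul_pos (Real.exp_pos _) (hz i)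
  · rw [Function.update_of_ne hi]
    exact hz i

end Summit.AtomisticToContinuum.BoseEinsteinCondensation.Cruxes.GroundStateStability.StableConeVariationalSelection

end
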